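import Summits.AtomisticToContinuum.HydrodynamicLimit.Theorems.InformationPercolationEngineCollisionRateCoreEquivalence
import HarnessLib

/-!
# Candidate ITEM TEXT for the promoted stub T34p of crux stmt-AtomisticToContinuum-13481 (`CollisionRate`), line `Sketch`

Lead c9 (prover-line-stmt-AtomisticToContinuum-13481-c9-0), 2026-08-17.  NOT a proposal: a planner-facing, farm-checked rendering of
the line's one open kinetic stub `Stubs.stub_evenTubeTimeStatProbLG` (skeleton `Cruxes/CollisionRate/Lines/Sketch.lean`, v27) as a
route-file declaration — every constant FULLY QUALIFIED, no `open`, no local notation, so that the text elaborates standalone in any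
`Theses/` or `Theorems/` context (the failure mode recorded on stmt-13677: "signature does not elaborate standalone").  The three
`example`s are kernel checks that (1) the text is SYNTACTICALLY the hypothesis consumed by the tree transfer
`Theorems.CollisionRate.collisionRate_of_lanfordEnvelopeR_of_evenTubeTimeStatProb` (proof by that theorem applied to the hypothesis
verbatim), (2) given the existing crux `BGEndpointRigidity.LanfordEnvelopeR` (stmt-13677) it is EQUIVALENT to the crux
(`collisionRate_iff_evenTubeTimeStatProb_of_lanfordEnvelopeR`), (3) it holds at global equilibrium (`evenTubeTimeStatProb_const`).
-/

namespace Summit.AtomisticToContinuum.HydrodynamicLimit.Cruxes.CollisionRate.Promote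

/-- **T34p as an item** (`EvenTubeTimeStatProb`; informal: THE TIME-INTEGRATED BOLTZMANN CYLINDER AGAINST ENSKOG'S PREDICTION, IN
PROBABILITY, for the deterministic hard-sphere flow at FIXED reduced diameter `σ`).  ∃ universal `η₀ > 0`; for continuous positive
local-Gibbs profiles, `σ < σ₀(profiles)`, every flow family `Φ`, horizon `τ > 0`, continuous localiser `χ`, continuous cutoff `g`
vanishing on `[η₀, ∞)`, accuracies `η, δ > 0`: ∃ `r₀` ∀ `r < r₀` ∃ `L₀` ∀ `L ≥ L₀` ∃ `κ₀` ∀ `κ < κ₀` ∃ `N₀` ∀ `N ≥ N₀`,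
`P_LG(|∫₀^τ W_t(Φ_t z) dt| > η) ≤ δ`, where `W_t = evenTubeStat … t` is the fixed-time even tube functional at the speed-truncated
unit mark `Ξ₁ᴸ(n, v, w) = ψ_L(‖w − v‖)`: `((N+1)κ)⁻¹ ×` the `χ g(σ³ρ_r)`-marked number of ordered pairs that are apart, approaching
and due to touch within flight time `κ ε_N` under free pair flight (Boltzmann's collision cylinder read on ONE configuration), minus
`σ³ ×` Enskog's rate `∫ χ g(σ³ρ_r) Y(σ³ρ_r) B_r(Ξ₁ᴸ) dx` of the SAME configuration (`Y = (3/2π) f_ex′` the contact value).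
Status: OPEN (Boltzmann–Enskog pre-collisional chaos with contact value, fixed `σ`, all `τ`); crux-equivalent given the marginal
envelope (A) ⇐ stmt-13677; true at rung 0. [folklore] -/
def EvenTubeTimeStatProb : Prop :=
  ∃ η₀ : ℝ, 0 < η₀ ∧ ∀ (a₀ θ₀ : Literature.MathematicalPhysics.KineticTheory.T3 → ℝ)
    (u₀ : Literature.MathematicalPhysics.KineticTheory.T3 → Literature.MathematicalPhysics.KineticTheory.V3),
    Continuous a₀ → Continuous θ₀ → Continuous u₀ → (∀ x, 0 < a₀ x) → (∀ x, 0 < θ₀ x) →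
    ∃ σ₀ : ℝ, 0 < σ₀ ∧ ∀ σ : ℝ, 0 < σ → σ < σ₀ →
    ∀ Φ : (N : ℕ) → Literature.Analysis.FluidPDE.HardSphereFlow (Literature.Analysis.FluidPDE.Torus.geometry (Fin 3))
      (Literature.MathematicalPhysics.KineticTheory.hsDiameter σ N) (N + 1),
    ∀ τ : ℝ, 0 < τ → ∀ χ : ℝ × Literature.MathematicalPhysics.KineticTheory.T3 → ℝ, Continuous χ →
    ∀ g : ℝ → ℝ, Continuous g → (∀ x, η₀ ≤ x → g x = 0) →
    ∀ η δ : ℝ, 0 < η → 0 < δ → ∃ r₀ : ℝ, 0 < r₀ ∧ ∀ r : ℝ, 0 < r → r < r₀ →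
    ∃ L₀ : ℝ, ∀ L : ℝ, L₀ ≤ L → ∃ κ₀ : ℝ, 0 < κ₀ ∧ ∀ κ : ℝ, 0 < κ → κ < κ₀ → ∃ N₀ : ℕ, ∀ N : ℕ, N₀ ≤ N →
      Literature.MathematicalPhysics.KineticTheory.localGibbsLaw σ a₀ u₀ θ₀ N (Φ N)
        {z | η < |Literature.MathematicalPhysics.KineticTheory.evenTubeTimeStat σ N (Φ N) τ χ g
          (fun q : Literature.MathematicalPhysics.KineticTheory.V3 × Literature.MathematicalPhysics.KineticTheory.V3 ×
              Literature.MathematicalPhysics.KineticTheory.V3 =>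
            Literature.MathematicalPhysics.KineticTheory.speedCutoff L ‖q.2.2 - q.2.1‖) r κ z|}
        ≤ ENNReal.ofReal δ

/-- (1) The item text is verbatim the hypothesis of the tree transfer: `LanfordEnvelopeR → EvenTubeTimeStatProb → CollisionRate`. -/
example (hE : Summit.AtomisticToContinuum.HydrodynamicLimit.Theses.BGEndpointRigidity.LanfordEnvelopeR)
    (hT : EvenTubeTimeStatProb) :
    Summit.AtomisticToContinuum.HydrodynamicLimit.Theses.InformationPercolationEngine.CollisionRate :=
  Summit.AtomisticToContinuum.HydrodynamicLimit.Theorems.CollisionRate.collisionRate_of_lanfordEnvelopeR_of_evenTubeTimeStatProb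
    hE hT

/-- (2) Given stmt-13677 the item is EQUIVALENT to the crux. -/
example (hE : Summit.AtomisticToContinuum.HydrodynamicLimit.Theses.BGEndpointRigidity.LanfordEnvelopeR) :
    Summit.AtomisticToContinuum.HydrodynamicLimit.Theses.InformationPercolationEngine.CollisionRate ↔ EvenTubeTimeStatProb :=
  Summit.AtomisticToContinuum.HydrodynamicLimit.Theorems.CollisionRate.collisionRate_iff_evenTubeTimeStatProb_of_lanfordEnvelopeR
    hE

/-- (3) The constant-profile (rung-0) instance of the item is a tree theorem. -/
example : ∃ η₀ : ℝ, 0 < η₀ ∧ ∀ (ab θb : ℝ) (ub : Literature.MathematicalPhysics.KineticTheory.V3), 0 < ab → 0 < θb →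
    ∃ σ₀ : ℝ, 0 < σ₀ ∧ ∀ σ : ℝ, 0 < σ → σ < σ₀ →
    ∀ Φ : (N : ℕ) → Literature.Analysis.FluidPDE.HardSphereFlow (Literature.Analysis.FluidPDE.Torus.geometry (Fin 3))
      (Literature.MathematicalPhysics.KineticTheory.hsDiameter σ N) (N + 1),
    ∀ τ : ℝ, 0 < τ → ∀ χ : ℝ × Literature.MathematicalPhysics.KineticTheory.T3 → ℝ, Continuous χ →
    ∀ g : ℝ → ℝ, Continuous g → (∀ x, η₀ ≤ x → g x = 0) →
    ∀ η δ : ℝ, 0 < η → 0 < δ → ∃ r₀ : ℝ, 0 < r₀ ∧ ∀ r : ℝ, 0 < r → r < r₀ →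
    ∃ L₀ : ℝ, ∀ L : ℝ, L₀ ≤ L → ∃ κ₀ : ℝ, 0 < κ₀ ∧ ∀ κ : ℝ, 0 < κ → κ < κ₀ → ∃ N₀ : ℕ, ∀ N : ℕ, N₀ ≤ N →
      Literature.MathematicalPhysics.KineticTheory.localGibbsLaw σ (fun _ => ab) (fun _ => ub) (fun _ => θb) N (Φ N)
        {z | η < |Literature.MathematicalPhysics.KineticTheory.evenTubeTimeStat σ N (Φ N) τ χ g
          (fun q : Literature.MathematicalPhysics.KineticTheory.V3 × Literature.MathematicalPhysics.KineticTheory.V3 ×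
              Literature.MathematicalPhysics.KineticTheory.V3 =>
            Literature.MathematicalPhysics.KineticTheory.speedCutoff L ‖q.2.2 - q.2.1‖) r κ z|}
        ≤ ENNReal.ofReal δ :=
  Summit.AtomisticToContinuum.HydrodynamicLimit.Theorems.CollisionRate.evenTubeTimeStatProb_const

end Summit.AtomisticToContinuum.HydrodynamicLimit.Cruxes.CollisionRate.Promote
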